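import Summits.AtomisticToContinuum.BoseEinsteinCondensation.Theorems.BECInsertionVarianceGroundStateAccessibleHardCoreGlue
import Literature.MathematicalPhysics.QuantumManyBody.OneParticleMarginals
import Mathlib.MeasureTheory.Measure.Haar.NormedSpace
import HarnessLib

/-!
# `GroundStateAccessible`, hard-core branch: the density defect is a two-point functional of the
# one-body density

Helper for item `GroundStateAccessible` (stmt-AtomisticToContinuum-12069) of route `BECInsertionVariance`
(`Summit.AtomisticToContinuum.BoseEinsteinCondensation.Theses.BECInsertionVariance.GroundStateAccessible`).

In the two-replica picture of a Bose-symmetric real wave function `Φ` of `n + 1` particles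
(`p = Φ(X)²Φ(Y)²`), the DENSITY DEFECT of `…GroundStateAccessibleDefectGlue.lean` — the `p`-mass of the
cross-close pairs `E_R = {∃ j ≠ 0, |y₀ − x_j| ≤ R ∨ |x₀ − y_j| ≤ R}` (a teleported boson lands within `R`
of a particle of the receiving replica) — is controlled by the one-body marginal
`ρ̄(x) = ∫ Φ(x, X̂)² dX̂` (`= sliceMass`, the one-particle density divided by `N`) alone:

* `densityDefect_le_of_symm` — `p(E_R) ≤ 2n ∫ ρ̄(x) (∫_{|y − x| ≤ R} ρ̄(y) dy) dx`
  (union bound over `j ≠ 0`; Bose symmetry moves `j` to `0`, where the event only involves the two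
  tagged particles; Tonelli);
* `densityDefect_le_of_sliceMass_le` — hence `p(E_R) ≤ 2n · m · |B_R|` whenever `ρ̄ ≤ m` pointwise and
  `∫ Φ² = 1`; with `m = Cρ/N` (a one-body density bound `ρ_Ψ ≤ Cρ`) this is `≤ 2C ρ |B_R|`, small at
  low density — the form in which the item's informal proof sketch uses "an L² (or sup ≤ Cρ) bound on
  the one-body density of Ψ₀, uniformly in N".

So the density half of the hard-core branch of the item is EXACTLY a statement about the one-body
density of the ground state (no correlations enter); what is not in print is that bound itself for the
Dirichlet ground state uniformly along the thermodynamic sequence.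
-/

noncomputable section

open MeasureTheory Filter Set Metric
open scoped ENNReal NNReal Topology

namespace Summit.AtomisticToContinuum.BoseEinsteinCondensation.Theorems.BECInsertionVariance

open Literature.MathematicalPhysics.QuantumManyBody.BoseGas

variable {n : ℕ}

/-! ### Relabelling one replica -/

/-- Relabelling the particles preserves Lebesgue measure on `(ℝ³)^{n+1}`. [folklore] -/
theorem measurePreserving_comp_perm_config (σ : Equiv.Perm (Fin (n + 1))) :
    MeasurePreserving (fun X : Config (n + 1) => X ∘ σ) volume volume := by
  have h := (volume_measurePreserving_piCongrLeft (fun _ : Fin (n + 1) => Space) σ).symm _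
  have e : ⇑(MeasurableEquiv.piCongrLeft (fun _ : Fin (n + 1) => Space) σ).symm =
      fun (X : Config (n + 1)) => X ∘ σ := by
    funext X
    ext i : 1
    simp [MeasurableEquiv.piCongrLeft, Equiv.piCongrLeft_symm_apply]
  rw [e] at h
  exact h

/-- Relabelling the FIRST replica preserves Lebesgue measure on pairs of configurations. [folklore] -/
theorem measurePreserving_relabel_fst (σ : Equiv.Perm (Fin (n + 1))) :
    MeasurePreserving (fun Z : Config (n + 1) × Config (n + 1) => (Z.1 ∘ σ, Z.2)) volume volume :=
  (measurePreserving_comp_perm_config σ).prod (MeasurePreserving.id volume)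

/-- Relabelling the SECOND replica preserves Lebesgue measure on pairs of configurations. [folklore] -/
theorem measurePreserving_relabel_snd (σ : Equiv.Perm (Fin (n + 1))) :
    MeasurePreserving (fun Z : Config (n + 1) × Config (n + 1) => (Z.1, Z.2 ∘ σ)) volume volume :=
  (MeasurePreserving.id volume).prod (measurePreserving_comp_perm_config σ)

/-- The two-replica density `p = Φ² ⊗ Φ²` of a Bose-symmetric `Φ` is invariant under relabelling the
first replica. [folklore] -/
theorem replicaDensity_relabel_fst {Φ : Config (n + 1) → ℝ}
    (hsymm : ∀ (σ : Equiv.Perm (Fin (n + 1))) (X : Config (n + 1)), Φ (X ∘ σ) = Φ X)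
    (σ : Equiv.Perm (Fin (n + 1))) (Z : Config (n + 1) × Config (n + 1)) :
    replicaDensity Φ (Z.1 ∘ σ, Z.2) = replicaDensity Φ Z := by
  simp only [replicaDensity, hsymm]

/-- The two-replica density of a Bose-symmetric `Φ` is invariant under relabelling the second
replica. [folklore] -/
theorem replicaDensity_relabel_snd {Φ : Config (n + 1) → ℝ}
    (hsymm : ∀ (σ : Equiv.Perm (Fin (n + 1))) (X : Config (n + 1)), Φ (X ∘ σ) = Φ X)
    (σ : Equiv.Perm (Fin (n + 1))) (Z : Config (n + 1) × Config (n + 1)) :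
    replicaDensity Φ (Z.1, Z.2 ∘ σ) = replicaDensity Φ Z := by
  simp only [replicaDensity, hsymm]

/-! ### The one-particle events -/

/-- The event "particle `0` of the second replica is within `R` of particle `j` of the first" is
measurable. [folklore] -/
theorem measurableSet_close_snd_fst (j : Fin (n + 1)) (R : ℝ) :
    MeasurableSet {Z : Config (n + 1) × Config (n + 1) | dist (Z.2 0) (Z.1 j) ≤ R} :=
  measurableSet_le (((measurable_pi_apply 0).comp measurable_snd).dist
    ((measurable_pi_apply j).comp measurable_fst)) measurable_const

/-- The event "particle `0` of the first replica is within `R` of particle `j` of the second" is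
measurable. [folklore] -/
theorem measurableSet_close_fst_snd (j : Fin (n + 1)) (R : ℝ) :
    MeasurableSet {Z : Config (n + 1) × Config (n + 1) | dist (Z.1 0) (Z.2 j) ≤ R} :=
  measurableSet_le (((measurable_pi_apply 0).comp measurable_fst).dist
    ((measurable_pi_apply j).comp measurable_snd)) measurable_const

/-- The one-body marginal `ρ̄(x) = ∫ Φ(x, X̂)² dX̂` is measurable in `x`. [folklore] -/
theorem measurable_marginal {Φ : Config (n + 1) → ℝ} (hΦ : Measurable Φ) :
    Measurable fun x : Space => ∫⁻ Xh : Config n, ENNReal.ofReal (Φ (Matrix.vecCons x Xh) ^ 2) := by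
  have hF : Measurable fun p : Space × Config n =>
      ENNReal.ofReal (Φ (Matrix.vecCons p.1 p.2) ^ 2) :=
    ((hΦ.comp measurable_vecCons).pow_const 2).ennreal_ofReal
  exact hF.lintegral_prod_right'

/-- The local mass `x ↦ ∫_{|y − x| ≤ R} ρ̄(y) dy` of the one-body marginal is measurable in `x`.
[folklore] -/
theorem measurable_localMass {Φ : Config (n + 1) → ℝ} (hΦ : Measurable Φ) (R : ℝ) :
    Measurable fun x : Space => ∫⁻ y in closedBall x R,
      ∫⁻ Yh : Config n, ENNReal.ofReal (Φ (Matrix.vecCons y Yh) ^ 2) := by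
  have hS : MeasurableSet {p : Space × Space | dist p.2 p.1 ≤ R} :=
    measurableSet_le (measurable_snd.dist measurable_fst) measurable_const
  have hH : Measurable fun p : Space × Space =>
      ({p : Space × Space | dist p.2 p.1 ≤ R}).indicator
        (fun p => ∫⁻ Yh : Config n, ENNReal.ofReal (Φ (Matrix.vecCons p.2 Yh) ^ 2)) p :=
    ((measurable_marginal hΦ).comp measurable_snd).indicator hS
  have h2 : Measurable fun x : Space => ∫⁻ y : Space,
      ({p : Space × Space | dist p.2 p.1 ≤ R}).indicator
        (fun p => ∫⁻ Yh : Config n, ENNReal.ofReal (Φ (Matrix.vecCons p.2 Yh) ^ 2)) (x, y) :=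
    hH.lintegral_prod_right'
  have heq : (fun x : Space => ∫⁻ y in closedBall x R,
      ∫⁻ Yh : Config n, ENNReal.ofReal (Φ (Matrix.vecCons y Yh) ^ 2)) = fun x : Space => ∫⁻ y : Space,
      ({p : Space × Space | dist p.2 p.1 ≤ R}).indicator
        (fun p => ∫⁻ Yh : Config n, ENNReal.ofReal (Φ (Matrix.vecCons p.2 Yh) ^ 2)) (x, y) := by
    funext x
    rw [← lintegral_indicator measurableSet_closedBall]
    refine lintegral_congr fun y => ?_
    simp only [indicator, mem_setOf_eq, mem_closedBall]
  rw [heq]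
  exact h2

/-! ### The `j = 0` event: Tonelli -/

/-- **The tagged-pair event in one-body terms.** For measurable real `Φ`:
`∫∫ 𝟙{|y₀ − x₀| ≤ R} Φ(X)²Φ(Y)² dX dY = ∫ ρ̄(x) (∫_{|y−x| ≤ R} ρ̄(y) dy) dx` with
`ρ̄(x) = ∫ Φ(x, X̂)² dX̂` (integrate out the untagged particles of both replicas). [folklore] -/
theorem setLIntegral_close_zero_eq {Φ : Config (n + 1) → ℝ} (hΦ : Measurable Φ) (R : ℝ) :
    ∫⁻ Z in {Z : Config (n + 1) × Config (n + 1) | dist (Z.2 0) (Z.1 0) ≤ R},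
        ENNReal.ofReal (replicaDensity Φ Z) =
      ∫⁻ x : Space, (∫⁻ Xh : Config n, ENNReal.ofReal (Φ (Matrix.vecCons x Xh) ^ 2)) *
        ∫⁻ y in closedBall x R, ∫⁻ Yh : Config n, ENNReal.ofReal (Φ (Matrix.vecCons y Yh) ^ 2) := by
  set ρb : Space → ℝ≥0∞ := fun x => ∫⁻ Xh : Config n, ENNReal.ofReal (Φ (Matrix.vecCons x Xh) ^ 2)
    with hρb
  set G : Space → ℝ≥0∞ := fun x => ∫⁻ y in closedBall x R, ρb y with hG
  have hsq : Measurable fun X : Config (n + 1) => ENNReal.ofReal (Φ X ^ 2) :=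
    (hΦ.pow_const 2).ennreal_ofReal
  have hA : MeasurableSet {Z : Config (n + 1) × Config (n + 1) | dist (Z.2 0) (Z.1 0) ≤ R} :=
    measurableSet_close_snd_fst 0 R
  have hf : Measurable fun Z : Config (n + 1) × Config (n + 1) => ENNReal.ofReal (replicaDensity Φ Z) :=
    (measurable_replicaDensity hΦ).ennreal_ofReal
  -- inner integral at fixed `X`: integrate out the second replica
  have hinner : ∀ X : Config (n + 1),
      ∫⁻ Y, ({Z : Config (n + 1) × Config (n + 1) | dist (Z.2 0) (Z.1 0) ≤ R}).indicator
          (fun Z => ENNReal.ofReal (replicaDensity Φ Z)) (X, Y) =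
        ENNReal.ofReal (Φ X ^ 2) * G (X 0) := by
    intro X
    -- the indicator as a product
    have hpt : ∀ Y : Config (n + 1),
        ({Z : Config (n + 1) × Config (n + 1) | dist (Z.2 0) (Z.1 0) ≤ R}).indicator
            (fun Z => ENNReal.ofReal (replicaDensity Φ Z)) (X, Y) =
          ENNReal.ofReal (Φ X ^ 2) *
            ({Y : Config (n + 1) | dist (Y 0) (X 0) ≤ R}).indicator
              (fun Y => ENNReal.ofReal (Φ Y ^ 2)) Y := by
      intro Y
      by_cases h : dist (Y 0) (X 0) ≤ R
      · rw [indicator_of_mem (show (X, Y) ∈ {Z : Config (n + 1) × Config (n + 1) |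
            dist (Z.2 0) (Z.1 0) ≤ R} from h), indicator_of_mem (show Y ∈ {Y : Config (n + 1) |
            dist (Y 0) (X 0) ≤ R} from h), replicaDensity,
          ENNReal.ofReal_mul (sq_nonneg _)]
      · rw [indicator_of_notMem (show (X, Y) ∉ {Z : Config (n + 1) × Config (n + 1) |
            dist (Z.2 0) (Z.1 0) ≤ R} from h), indicator_of_notMem (show Y ∉ {Y : Config (n + 1) |
            dist (Y 0) (X 0) ≤ R} from h), mul_zero]
    have hS : MeasurableSet {Y : Config (n + 1) | dist (Y 0) (X 0) ≤ R} :=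
      measurableSet_le ((measurable_pi_apply 0).dist measurable_const) measurable_const
    simp_rw [hpt]
    rw [lintegral_const_mul _ (hsq.indicator hS)]
    congr 1
    -- `∫ 𝟙{|y₀ - x₀| ≤ R} Φ(Y)² dY = ∫_{|y - x₀| ≤ R} ρ̄(y) dy`
    rw [← lintegral_lintegral_vecCons (F := ({Y : Config (n + 1) | dist (Y 0) (X 0) ≤ R}).indicator
      fun Y => ENNReal.ofReal (Φ Y ^ 2)) (hsq.indicator hS)]
    rw [hG]
    simp only
    rw [← lintegral_indicator measurableSet_closedBall]
    refine lintegral_congr fun y => ?_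
    by_cases hy : dist y (X 0) ≤ R
    · rw [indicator_of_mem (mem_closedBall.2 hy)]
      show _ = ∫⁻ Xh : Config n, ENNReal.ofReal (Φ (Matrix.vecCons y Xh) ^ 2)
      refine lintegral_congr fun Yh => ?_
      rw [indicator_of_mem]
      show dist (Matrix.vecCons y Yh 0) (X 0) ≤ R
      simpa using hy
    · rw [indicator_of_notMem (fun h => hy (mem_closedBall.1 h))]
      refine (lintegral_congr fun Yh => ?_).trans lintegral_zero
      rw [indicator_of_notMem]
      show ¬ dist (Matrix.vecCons y Yh 0) (X 0) ≤ R
      simpa using hy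
  -- outer integral: integrate out the first replica
  have hGm : Measurable G := measurable_localMass hΦ R
  calc ∫⁻ Z in {Z : Config (n + 1) × Config (n + 1) | dist (Z.2 0) (Z.1 0) ≤ R},
        ENNReal.ofReal (replicaDensity Φ Z)
      = ∫⁻ Z, ({Z : Config (n + 1) × Config (n + 1) | dist (Z.2 0) (Z.1 0) ≤ R}).indicator
          (fun Z => ENNReal.ofReal (replicaDensity Φ Z)) Z := (lintegral_indicator hA _).symm
    _ = ∫⁻ X, ∫⁻ Y, ({Z : Config (n + 1) × Config (n + 1) | dist (Z.2 0) (Z.1 0) ≤ R}).indicator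
          (fun Z => ENNReal.ofReal (replicaDensity Φ Z)) (X, Y) := by
        rw [Measure.volume_eq_prod]
        exact lintegral_prod _ (hf.indicator hA).aemeasurable
    _ = ∫⁻ X, ENNReal.ofReal (Φ X ^ 2) * G (X 0) := lintegral_congr hinner
    _ = ∫⁻ x, ∫⁻ Xh : Config n, ENNReal.ofReal (Φ (Matrix.vecCons x Xh) ^ 2) *
          G (Matrix.vecCons x Xh 0) :=
        (lintegral_lintegral_vecCons (F := fun X => ENNReal.ofReal (Φ X ^ 2) * G (X 0))
          (hsq.mul (hGm.comp (measurable_pi_apply 0)))).symm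
    _ = ∫⁻ x, ρb x * G x := by
        refine lintegral_congr fun x => ?_
        have hmx : Measurable fun Xh : Config n => ENNReal.ofReal (Φ (Matrix.vecCons x Xh) ^ 2) :=
          hsq.comp (measurable_vecCons_right x)
        simp only [Matrix.cons_val_zero]
        exact lintegral_mul_const _ hmx

/-! ### The union bound -/

/-- **Density defect ≤ a two-point functional of the one-body marginal.** For a measurable,
Bose-symmetric real `Φ` on `(ℝ³)^{n+1}` and a length `R`, the `p`-mass of the cross-close pairs is
`≤ 2n ∫ ρ̄(x) (∫_{|y−x| ≤ R} ρ̄(y) dy) dx`, `ρ̄(x) = ∫ Φ(x, X̂)² dX̂`: union bound over the `2n`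
one-particle events, each moved to the tagged pair `(x₀, y₀)` by a transposition of labels (Bose
symmetry + invariance of Lebesgue measure), then `setLIntegral_close_zero_eq`. [folklore] -/
theorem densityDefect_le_of_symm {Φ : Config (n + 1) → ℝ} (hΦ : Measurable Φ)
    (hsymm : ∀ (σ : Equiv.Perm (Fin (n + 1))) (X : Config (n + 1)), Φ (X ∘ σ) = Φ X) (R : ℝ) :
    ∫⁻ Z in {Z : Config (n + 1) × Config (n + 1) |
        ∃ j : Fin (n + 1), j ≠ 0 ∧ (dist (Z.2 0) (Z.1 j) ≤ R ∨ dist (Z.1 0) (Z.2 j) ≤ R)},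
        ENNReal.ofReal (replicaDensity Φ Z) ≤
      2 * n * ∫⁻ x : Space, (∫⁻ Xh : Config n, ENNReal.ofReal (Φ (Matrix.vecCons x Xh) ^ 2)) *
        ∫⁻ y in closedBall x R, ∫⁻ Yh : Config n, ENNReal.ofReal (Φ (Matrix.vecCons y Yh) ^ 2) := by
  set f : Config (n + 1) × Config (n + 1) → ℝ≥0∞ := fun Z => ENNReal.ofReal (replicaDensity Φ Z)
    with hfdef
  have hf : Measurable f := (measurable_replicaDensity hΦ).ennreal_ofReal
  set μ : Measure (Config (n + 1) × Config (n + 1)) := volume.withDensity f with hμ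
  set A : Fin (n + 1) → Set (Config (n + 1) × Config (n + 1)) :=
    fun j => {Z | dist (Z.2 0) (Z.1 j) ≤ R} with hAdef
  set B : Fin (n + 1) → Set (Config (n + 1) × Config (n + 1)) :=
    fun j => {Z | dist (Z.1 0) (Z.2 j) ≤ R} with hBdef
  have hAm : ∀ j, MeasurableSet (A j) := fun j => measurableSet_close_snd_fst j R
  have hBm : ∀ j, MeasurableSet (B j) := fun j => measurableSet_close_fst_snd j R
  set S : Finset (Fin (n + 1)) := Finset.univ.filter fun j => j ≠ 0 with hSdef
  -- the event as a finite union
  have hE : {Z : Config (n + 1) × Config (n + 1) |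
      ∃ j : Fin (n + 1), j ≠ 0 ∧ (dist (Z.2 0) (Z.1 j) ≤ R ∨ dist (Z.1 0) (Z.2 j) ≤ R)} =
      ⋃ j ∈ S, (A j ∪ B j) := by
    ext Z
    simp only [hSdef, hAdef, hBdef, mem_setOf_eq, mem_iUnion, mem_union, exists_prop,
      Finset.mem_filter, Finset.mem_univ, true_and]
  have hEm : MeasurableSet (⋃ j ∈ S, (A j ∪ B j)) :=
    MeasurableSet.biUnion (Set.to_countable _) fun j _ => (hAm j).union (hBm j)
  -- each one-particle event has the mass of the tagged-pair event
  have hA0 : ∀ j, μ (A j) = μ (A 0) := by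
    intro j
    rw [hμ, withDensity_apply _ (hAm j), withDensity_apply _ (hAm 0)]
    have hpre : (fun Z : Config (n + 1) × Config (n + 1) => (Z.1 ∘ Equiv.swap 0 j, Z.2)) ⁻¹' (A 0) =
        A j := by
      ext Z
      simp [hAdef]
    have h := (measurePreserving_relabel_fst (n := n) (Equiv.swap 0 j)).setLIntegral_comp_preimage
      (hAm 0) hf
    rw [hpre] at h
    rw [← h]
    refine setLIntegral_congr_fun (hAm j) (fun Z _ => ?_)
    simp only [hfdef, replicaDensity_relabel_fst hsymm]
  have hB0 : ∀ j, μ (B j) = μ (A 0) := by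
    intro j
    have hBA : B 0 = A 0 := by
      ext Z
      simp only [hAdef, hBdef, mem_setOf_eq, dist_comm]
    rw [← hBA, hμ, withDensity_apply _ (hBm j), withDensity_apply _ (hBm 0)]
    have hpre : (fun Z : Config (n + 1) × Config (n + 1) => (Z.1, Z.2 ∘ Equiv.swap 0 j)) ⁻¹' (B 0) =
        B j := by
      ext Z
      simp [hBdef]
    have h := (measurePreserving_relabel_snd (n := n) (Equiv.swap 0 j)).setLIntegral_comp_preimage
      (hBm 0) hf
    rw [hpre] at h
    rw [← h]
    refine setLIntegral_congr_fun (hBm j) (fun Z _ => ?_)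
    simp only [hfdef, replicaDensity_relabel_snd hsymm]
  -- cardinality of `{j ≠ 0}`
  have hcard : S.card = n := by
    rw [hSdef, Finset.filter_ne', Finset.card_erase_of_mem (Finset.mem_univ _), Finset.card_univ,
      Fintype.card_fin, Nat.add_sub_cancel]
  -- the union bound
  have hunion : μ (⋃ j ∈ S, (A j ∪ B j)) ≤ 2 * n * μ (A 0) := by
    calc μ (⋃ j ∈ S, (A j ∪ B j)) ≤ ∑ j ∈ S, μ (A j ∪ B j) := measure_biUnion_finset_le S _
      _ ≤ ∑ j ∈ S, (μ (A 0) + μ (A 0)) := Finset.sum_le_sum fun j _ =>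
          (measure_union_le _ _).trans (by rw [hA0 j, hB0 j])
      _ = 2 * n * μ (A 0) := by
          rw [Finset.sum_const, hcard, nsmul_eq_mul, ← two_mul, ← mul_assoc, mul_comm (n : ℝ≥0∞) 2]
  -- translate back to set integrals
  have hμE : ∫⁻ Z in ⋃ j ∈ S, (A j ∪ B j), f Z = μ (⋃ j ∈ S, (A j ∪ B j)) := by
    rw [hμ, withDensity_apply _ hEm]
  have hμA : μ (A 0) = ∫⁻ Z in A 0, f Z := by rw [hμ, withDensity_apply _ (hAm 0)]
  rw [hE, hμE]
  refine hunion.trans ?_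
  rw [hμA, hAdef, hfdef]
  simp only
  rw [setLIntegral_close_zero_eq hΦ R]

/-- **Density defect under a pointwise one-body bound.** If moreover `∫ Φ² = 1` and the one-body
marginal is bounded, `ρ̄ ≤ m` pointwise (`ρ̄(x) = ∫ Φ(x, X̂)² dX̂ = ρ_Φ(x)/(n+1)`), then the density defect
is `≤ 2n · m · |B_R|`; for `m = Cρ/(n+1)` (one-body density `≤ Cρ`) this is `≤ 2Cρ|B_R|`, uniformly in
`n`. [folklore] -/
theorem densityDefect_le_of_marginal_le {Φ : Config (n + 1) → ℝ} (hΦ : Measurable Φ)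
    (hsymm : ∀ (σ : Equiv.Perm (Fin (n + 1))) (X : Config (n + 1)), Φ (X ∘ σ) = Φ X)
    (h1 : ∫⁻ X, ENNReal.ofReal (Φ X ^ 2) = 1) {R : ℝ} {m : ℝ≥0∞}
    (hm : ∀ x : Space, (∫⁻ Xh : Config n, ENNReal.ofReal (Φ (Matrix.vecCons x Xh) ^ 2)) ≤ m) :
    ∫⁻ Z in {Z : Config (n + 1) × Config (n + 1) |
        ∃ j : Fin (n + 1), j ≠ 0 ∧ (dist (Z.2 0) (Z.1 j) ≤ R ∨ dist (Z.1 0) (Z.2 j) ≤ R)},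
        ENNReal.ofReal (replicaDensity Φ Z) ≤
      2 * n * (m * volume (closedBall (0 : Space) R)) := by
  refine (densityDefect_le_of_symm hΦ hsymm R).trans (mul_le_mul' le_rfl ?_)
  -- `∫ ρ̄(x) (∫_{B(x,R)} ρ̄) dx ≤ ∫ ρ̄(x) · (m |B_R|) dx = m |B_R|`
  have hloc : ∀ x : Space, (∫⁻ y in closedBall x R,
      ∫⁻ Yh : Config n, ENNReal.ofReal (Φ (Matrix.vecCons y Yh) ^ 2)) ≤
        m * volume (closedBall (0 : Space) R) := by
    intro x
    calc (∫⁻ y in closedBall x R, ∫⁻ Yh : Config n, ENNReal.ofReal (Φ (Matrix.vecCons y Yh) ^ 2))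
        ≤ ∫⁻ _y in closedBall x R, m := setLIntegral_mono measurable_const fun y _ => hm y
      _ = m * volume (closedBall (0 : Space) R) := by
          rw [setLIntegral_const, Measure.addHaar_closedBall_center]
  have htot : ∫⁻ x : Space, (∫⁻ Xh : Config n, ENNReal.ofReal (Φ (Matrix.vecCons x Xh) ^ 2)) = 1 := by
    rw [lintegral_lintegral_vecCons (F := fun X => ENNReal.ofReal (Φ X ^ 2))
      ((hΦ.pow_const 2).ennreal_ofReal), h1]
  calc (∫⁻ x : Space, (∫⁻ Xh : Config n, ENNReal.ofReal (Φ (Matrix.vecCons x Xh) ^ 2)) *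
        ∫⁻ y in closedBall x R, ∫⁻ Yh : Config n, ENNReal.ofReal (Φ (Matrix.vecCons y Yh) ^ 2))
      ≤ ∫⁻ x : Space, (∫⁻ Xh : Config n, ENNReal.ofReal (Φ (Matrix.vecCons x Xh) ^ 2)) *
          (m * volume (closedBall (0 : Space) R)) :=
        lintegral_mono fun x => mul_le_mul' le_rfl (hloc x)
    _ = m * volume (closedBall (0 : Space) R) := by
        rw [lintegral_mul_const _ (measurable_marginal hΦ), htot, one_mul]

end Summit.AtomisticToContinuum.BoseEinsteinCondensation.Theorems.BECInsertionVariance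

end
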